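import Literature.NumberTheory.LFunctions.MoebiusVaughanTypeReduction
import HarnessLib

/-!
# Vaughan's identity for `μ`: the reduction to blocks with the type-II roles swapped above `v` (proved)

Everything in this file is PROVED (plus one plain definition). It refines the reduction
`MRVaughan.norm_sum_moebius_smul_le_blocks` (`MoebiusVaughanTypeReduction.lean`: the
`μ`-analogue of C. Mauduit, J. Rivat, Ann. of Math. 171 (2010), Lemme 1, from the three-term
identity `μ = 2μ_u − (μ_u*μ_u)*1 + G_u*(μ−μ_u)`). There the type-II double sum
`∑_{k,ℓ} G_u(k) β(ℓ) g̃(kℓ)` is opened by Cauchy–Schwarz in the variable `k ∈ [q^j, q^{j+1})`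
for ALL blocks `u < k ≤ x/u`, so that the smooth variable `k` may be longer than the
coefficient variable `ℓ`. Mauduit–Rivat's type-II estimate (J. Eur. Math. Soc. 17 (2015),
Prop. 2, condition (46): `M ≤ N`) wants the smooth variable to be the SHORTER one; in [24,
Lemme 1] this is harmless because both coefficient sequences there are `1`-bounded and the sum
is symmetric. Here we supply the corresponding bookkeeping for the `μ`-identity: the `k`-range
is split at a parameter `v` (typically `v ≈ √x`),

* for `u < k ≤ v` we proceed as before (smooth `k`, coefficients `β_u(ℓ) = μ(ℓ)𝟙_{ℓ>u}`);
* for `v < k ≤ x` we swap: the smooth variable is `ℓ ∈ (u, x/v]`, opened by Cauchy–Schwarz on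
  blocks `[q^i, q^{i+1})`, and the coefficients are `swapCoeff u v k = G_u(k) 𝟙_{k>v}`
  (`|G_u| ≤ τ`, NOT `1`-bounded: the consumer rescales, `blockII_const_mul`).

Main statement: `norm_sum_moebius_smul_le_blocks_swap`.

## References
* C. Mauduit, J. Rivat, Ann. of Math. 171 (2010) 1591–1646, Lemme 1 (p. 1598). [MauduitRivat2010]
* C. Mauduit, J. Rivat, J. Eur. Math. Soc. 17 (2015) 2595–2642, Prop. 2, (46), §8.
  [MauduitRivat2015]
* C. Müllner, Duke Math. J. 166 (2017), Thm. 4.4. [Mullner2017]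
-/

noncomputable section

open Finset Real ArithmeticFunction
open scoped ArithmeticFunction.Moebius ArithmeticFunction.zeta ArithmeticFunction.sigma

namespace Literature.NumberTheory.LFunctions.MRVaughan

open Literature.NumberTheory.Sieve (moebiusTrunc)
open Literature.NumberTheory.Sieve.Vaughan (gU gU_eq_zero_of_le abs_gU_le sum_sq_card_divisors_le)
open Literature.NumberTheory.LFunctions.MoebiusWalshVaughan (typeICoeff abs_typeICoeff_le
  typeICoeff_eq_zero typeIICoeffB typeIICoeffB_apply abs_typeIICoeffB_le typeIICoeffB_eq_zero)

variable {E : Type*} [NormedAddCommGroup E] [NormedSpace ℝ E]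

/-! ## The swapped coefficients -/

/-- The coefficients of the swapped type-II sum: `G_u(k) 𝟙_{k > v}`.
[cite: MauduitRivat2010, Lemme 1 (proof, the sum S₃)] -/
def swapCoeff (u v k : ℕ) : ℝ := if v < k then gU u k else 0

/-- `|G_u(k) 𝟙_{k>v}| ≤ τ(k)`. [folklore] -/
theorem abs_swapCoeff_le (u v k : ℕ) : |swapCoeff u v k| ≤ σ 0 k := by
  rw [swapCoeff]
  split_ifs
  · exact abs_gU_le u k
  · rw [abs_zero]; positivity

/-- `swapCoeff u v k = 0` for `k ≤ v`. [folklore] -/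
theorem swapCoeff_eq_zero_of_le {u v k : ℕ} (h : k ≤ v) : swapCoeff u v k = 0 := by
  rw [swapCoeff, if_neg (not_lt.2 h)]

/-- Scaling the coefficients scales `blockII` quadratically. [folklore] -/
theorem blockII_const_mul (q x j : ℕ) (t : ℝ) (b : ℕ → ℝ) (g : ℕ → E) :
    blockII q x j (fun ℓ => t * b ℓ) g = t ^ 2 * blockII q x j b g := by
  rw [blockII, blockII, mul_sum]
  refine sum_congr rfl fun k _ => ?_
  have : ∑ ℓ ∈ Ioc 0 x, (t * b ℓ) • hypCut q x g (k * ℓ) =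
      t • ∑ ℓ ∈ Ioc 0 x, b ℓ • hypCut q x g (k * ℓ) := by
    rw [smul_sum]
    exact sum_congr rfl fun ℓ _ => mul_smul _ _ _
  rw [this, norm_smul, mul_pow, Real.norm_eq_abs, sq_abs]

/-! ## The swapped inner sums vanish beyond `x / v` -/

/-- For `ℓ > x/v` every `k > v` has `ℓ k > x`, so the swapped inner sum at `ℓ` vanishes. [folklore] -/
theorem sum_swapCoeff_smul_hypCut_eq_zero {q x u v ℓ : ℕ} (hv : 0 < v) (hℓ : x / v < ℓ)
    (g : ℕ → E) : ∑ k ∈ Ioc 0 x, swapCoeff u v k • hypCut q x g (ℓ * k) = 0 := by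
  refine sum_eq_zero fun k _ => ?_
  by_cases hk : v < k
  · have hx : x < ℓ * k := by
      have h1 : x < v * (x / v + 1) := Nat.lt_mul_div_succ x hv
      have h2 : v * (x / v + 1) ≤ ℓ * k := by
        calc v * (x / v + 1) ≤ v * ℓ := Nat.mul_le_mul_left v hℓ
          _ = ℓ * v := mul_comm _ _
          _ ≤ ℓ * k := Nat.mul_le_mul_left ℓ hk.le
      exact lt_of_lt_of_le h1 h2
    rw [hypCut_eq_zero_of_lt g hx, smul_zero]
  · rw [swapCoeff_eq_zero_of_le (not_lt.1 hk), zero_smul]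

/-! ## The reduction with the split at `v` -/

omit [NormedSpace ℝ E] in
/-- Cauchy–Schwarz on a block against the constant weight:
`∑_{block i} a(ℓ) ≤ √(q^{i+1}) √(∑_{block i} a(ℓ)²)` for `a ≥ 0`. [folklore] -/
theorem sum_block_le_sqrt_mul_sqrt {q : ℕ} (i : ℕ) (a : ℕ → ℝ) :
    ∑ ℓ ∈ Ico (q ^ i) (q ^ (i + 1)), a ℓ ≤
      Real.sqrt ((q : ℝ) ^ (i + 1)) * Real.sqrt (∑ ℓ ∈ Ico (q ^ i) (q ^ (i + 1)), a ℓ ^ 2) := by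
  have h := Real.sum_mul_le_sqrt_mul_sqrt (Ico (q ^ i) (q ^ (i + 1))) (fun _ => (1 : ℝ)) a
  simp only [one_mul, one_pow, sum_const, nsmul_eq_mul, mul_one, Nat.card_Ico] at h
  refine h.trans (mul_le_mul_of_nonneg_right (Real.sqrt_le_sqrt ?_) (Real.sqrt_nonneg _))
  have : ((q ^ (i + 1) - q ^ i : ℕ) : ℝ) ≤ ((q ^ (i + 1) : ℕ) : ℝ) := by
    exact_mod_cast Nat.sub_le _ _
  simpa using this

/-- **The `μ`-analogue of Mauduit–Rivat 2010, Lemme 1, with the type-II roles swapped above `v`.**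
For `q ≥ 2`, `qu ≤ x`, `0 < v` and an `E`-valued weight with `‖g‖ ≤ 1`:
`‖∑_{x/q<n≤x} μ(n) g(n)‖ ≤ ∑_{j ≤ log_q u²} √(q^{j+1}(1+log q^{j+1})³) √(min((x/q^j) blockI_j, blockII_j(1)))`
`+ ∑_{log_q u ≤ j ≤ log_q v} √(q^{j+1}(1+log q^{j+1})³) √(blockII_j(β_u))`
`+ ∑_{log_q u ≤ i ≤ log_q (x/v)} √(q^{i+1}) √(blockII_i(G_u 𝟙_{>v}))`:
in the last sum the smooth (outer) variable of `blockII` is `ℓ ∈ [q^i, q^{i+1})`, `ℓ ≤ x/v`, and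
the coefficients `swapCoeff u v` sit on `k > v` (`|swapCoeff| ≤ τ`).
[cite: MauduitRivat2010, Lemme 1 (μ-analogue); MauduitRivat2015, (46) and §8] -/
theorem norm_sum_moebius_smul_le_blocks_swap {q x u v : ℕ} (hq : 2 ≤ q) (hu : q * u ≤ x)
    (hv : 0 < v) (hvx : v ≤ x) {g : ℕ → E} (hg : ∀ n, ‖g n‖ ≤ 1) :
    ‖∑ n ∈ (Ioc 0 x).filter (fun n => x < q * n), (μ n : ℝ) • g n‖ ≤
      ∑ j ∈ range (Nat.log q (u * u) + 1),
          Real.sqrt ((q : ℝ) ^ (j + 1) * (1 + Real.log ((q : ℝ) ^ (j + 1))) ^ 3) *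
            Real.sqrt (min ((x : ℝ) / q ^ j * blockI q x j g) (blockII q x j (fun _ => 1) g)) +
      ∑ j ∈ Ico (Nat.log q u) (Nat.log q v + 1),
          Real.sqrt ((q : ℝ) ^ (j + 1) * (1 + Real.log ((q : ℝ) ^ (j + 1))) ^ 3) *
            Real.sqrt (blockII q x j (typeIICoeffB u) g) +
      ∑ i ∈ Ico (Nat.log q u) (Nat.log q (x / v) + 1),
          Real.sqrt ((q : ℝ) ^ (i + 1)) * Real.sqrt (blockII q x i (swapCoeff u v) g) := by
  rw [sum_moebius_smul_hyp_eq hu g]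
  -- split the `k`-range of the type-II double sum at `v`
  have hsplitII : ∑ k ∈ Ioc 0 x, ∑ ℓ ∈ Ioc 0 x, (gU u k * typeIICoeffB u ℓ) • hypCut q x g (k * ℓ) =
      ∑ k ∈ Ioc 0 v, ∑ ℓ ∈ Ioc 0 x, (gU u k * typeIICoeffB u ℓ) • hypCut q x g (k * ℓ) +
        ∑ k ∈ Ioc v x, ∑ ℓ ∈ Ioc 0 x, (gU u k * typeIICoeffB u ℓ) • hypCut q x g (k * ℓ) :=
    (sum_Ioc_consecutive _ (Nat.zero_le v) hvx).symm
  rw [hsplitII, ← add_assoc]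
  refine (norm_add_le _ _).trans (add_le_add ((norm_add_le _ _).trans (add_le_add ?_ ?_)) ?_)
  · -- type I part: divisor-bounded coefficients out, blocks, Cauchy–Schwarz with the `min`
    rw [norm_neg]
    have h1 : ‖∑ a ∈ Ioc 0 x, ∑ b ∈ Ioc 0 x, typeICoeff u a • hypCut q x g (a * b)‖ ≤
        ∑ a ∈ Ioc 0 (u * u), (σ 0 a : ℝ) * ‖∑ b ∈ Ioc 0 x, hypCut q x g (a * b)‖ := by
      calc ‖∑ a ∈ Ioc 0 x, ∑ b ∈ Ioc 0 x, typeICoeff u a • hypCut q x g (a * b)‖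
          ≤ ∑ a ∈ Ioc 0 x, ‖∑ b ∈ Ioc 0 x, typeICoeff u a • hypCut q x g (a * b)‖ := norm_sum_le _ _
        _ = ∑ a ∈ Ioc 0 x, |typeICoeff u a| * ‖∑ b ∈ Ioc 0 x, hypCut q x g (a * b)‖ := by
            refine sum_congr rfl fun a _ => ?_
            rw [← smul_sum, norm_smul, Real.norm_eq_abs]
        _ = ∑ a ∈ (Ioc 0 x).filter (fun a => a ≤ u * u),
              |typeICoeff u a| * ‖∑ b ∈ Ioc 0 x, hypCut q x g (a * b)‖ := by
            rw [sum_filter]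
            refine sum_congr rfl fun a _ => ?_
            split_ifs with h
            · rfl
            · rw [typeICoeff_eq_zero (not_le.1 h), abs_zero, zero_mul]
        _ ≤ ∑ a ∈ Ioc 0 (u * u), |typeICoeff u a| * ‖∑ b ∈ Ioc 0 x, hypCut q x g (a * b)‖ := by
            refine sum_le_sum_of_subset_of_nonneg (fun a ha => ?_) (fun _ _ _ => by positivity)
            simp only [mem_filter, mem_Ioc] at ha ⊢
            exact ⟨ha.1.1, ha.2⟩
        _ ≤ ∑ a ∈ Ioc 0 (u * u), (σ 0 a : ℝ) * ‖∑ b ∈ Ioc 0 x, hypCut q x g (a * b)‖ := by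
            gcongr with a _
            exact abs_typeICoeff_le u a
    refine h1.trans ?_
    refine (sum_Ioc_le_sum_blocks hq (u * u) (fun a => by positivity)).trans (sum_le_sum fun j _ => ?_)
    refine (sum_block_card_divisors_mul_le q j _).trans ?_
    gcongr
    rw [le_min_iff]
    exact ⟨sum_block_norm_sq_le hq hg, (sum_block_norm_sq_eq_blockII q x j g).le⟩
  · -- type II part, `k ≤ v`: smooth variable `k`, as in `norm_sum_moebius_smul_le_blocks`
    have h3 : ‖∑ k ∈ Ioc 0 v, ∑ ℓ ∈ Ioc 0 x, (gU u k * typeIICoeffB u ℓ) • hypCut q x g (k * ℓ)‖ ≤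
        ∑ k ∈ Ioc u v, (σ 0 k : ℝ) * ‖∑ ℓ ∈ Ioc 0 x, typeIICoeffB u ℓ • hypCut q x g (k * ℓ)‖ := by
      calc ‖∑ k ∈ Ioc 0 v, ∑ ℓ ∈ Ioc 0 x, (gU u k * typeIICoeffB u ℓ) • hypCut q x g (k * ℓ)‖
          ≤ ∑ k ∈ Ioc 0 v, ‖∑ ℓ ∈ Ioc 0 x, (gU u k * typeIICoeffB u ℓ) • hypCut q x g (k * ℓ)‖ :=
            norm_sum_le _ _
        _ = ∑ k ∈ Ioc 0 v, |gU u k| * ‖∑ ℓ ∈ Ioc 0 x, typeIICoeffB u ℓ • hypCut q x g (k * ℓ)‖ := by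
            refine sum_congr rfl fun k _ => ?_
            rw [← Real.norm_eq_abs, ← norm_smul, smul_sum]
            congr 1
            exact sum_congr rfl fun ℓ _ => (mul_smul _ _ _)
        _ = ∑ k ∈ (Ioc 0 v).filter (fun k => u < k),
              |gU u k| * ‖∑ ℓ ∈ Ioc 0 x, typeIICoeffB u ℓ • hypCut q x g (k * ℓ)‖ := by
            rw [sum_filter]
            refine sum_congr rfl fun k _ => ?_
            split_ifs with h
            · rfl
            · rw [gU_eq_zero_of_le (not_lt.1 h), abs_zero, zero_mul]
        _ = ∑ k ∈ Ioc u v, |gU u k| * ‖∑ ℓ ∈ Ioc 0 x, typeIICoeffB u ℓ • hypCut q x g (k * ℓ)‖ := by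
            congr 1
            ext k
            simp only [mem_filter, mem_Ioc]
            omega
        _ ≤ ∑ k ∈ Ioc u v, (σ 0 k : ℝ) * ‖∑ ℓ ∈ Ioc 0 x, typeIICoeffB u ℓ • hypCut q x g (k * ℓ)‖ := by
            gcongr with k _
            exact abs_gU_le u k
    refine h3.trans ?_
    refine (sum_Ioc_le_sum_blocks_Ico hq u v (fun a => by positivity)).trans (sum_le_sum fun j _ => ?_)
    refine (sum_block_card_divisors_mul_le q j _).trans (le_of_eq ?_)
    rfl
  · -- swapped type II part, `v < k ≤ x`: smooth variable `ℓ`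
    set S : ℕ → E := fun ℓ => ∑ k ∈ Ioc 0 x, swapCoeff u v k • hypCut q x g (ℓ * k) with hS
    have hswap : ∑ k ∈ Ioc v x, ∑ ℓ ∈ Ioc 0 x, (gU u k * typeIICoeffB u ℓ) • hypCut q x g (k * ℓ) =
        ∑ ℓ ∈ Ioc 0 x, typeIICoeffB u ℓ • S ℓ := by
      rw [sum_comm]
      refine sum_congr rfl fun ℓ _ => ?_
      rw [hS]
      simp only
      rw [smul_sum]
      -- restrict the full range to `k > v`
      rw [← sum_Ioc_consecutive _ (Nat.zero_le v) hvx]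
      have h0 : ∑ k ∈ Ioc 0 v, typeIICoeffB u ℓ • (swapCoeff u v k • hypCut q x g (ℓ * k)) = 0 := by
        refine sum_eq_zero fun k hk => ?_
        rw [swapCoeff_eq_zero_of_le (mem_Ioc.1 hk).2, zero_smul, smul_zero]
      rw [h0, zero_add]
      refine sum_congr rfl fun k hk => ?_
      rw [swapCoeff, if_pos (mem_Ioc.1 hk).1, smul_smul, mul_comm (gU u k), mul_comm k ℓ]
    rw [hswap]
    -- `|β| ≤ 1`, `β = 0` on `[1,u]`, `S = 0` beyond `x/v`
    have h2 : ‖∑ ℓ ∈ Ioc 0 x, typeIICoeffB u ℓ • S ℓ‖ ≤ ∑ ℓ ∈ Ioc u (x / v), ‖S ℓ‖ := by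
      calc ‖∑ ℓ ∈ Ioc 0 x, typeIICoeffB u ℓ • S ℓ‖
          ≤ ∑ ℓ ∈ Ioc 0 x, ‖typeIICoeffB u ℓ • S ℓ‖ := norm_sum_le _ _
        _ = ∑ ℓ ∈ (Ioc 0 x).filter (fun ℓ => u < ℓ ∧ ℓ ≤ x / v), ‖typeIICoeffB u ℓ • S ℓ‖ := by
            rw [sum_filter]
            refine sum_congr rfl fun ℓ _ => ?_
            split_ifs with h
            · rfl
            · rw [not_and_or, not_lt, not_le] at h
              rcases h with h | h
              · rw [typeIICoeffB_eq_zero h, zero_smul, norm_zero]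
              · rw [hS]
                simp only
                rw [sum_swapCoeff_smul_hypCut_eq_zero hv h g, smul_zero, norm_zero]
        _ ≤ ∑ ℓ ∈ Ioc u (x / v), ‖typeIICoeffB u ℓ • S ℓ‖ := by
            refine sum_le_sum_of_subset_of_nonneg (fun ℓ hℓ => ?_) (fun _ _ _ => norm_nonneg _)
            simp only [mem_filter, mem_Ioc] at hℓ ⊢
            exact ⟨hℓ.2.1, hℓ.2.2⟩
        _ ≤ ∑ ℓ ∈ Ioc u (x / v), ‖S ℓ‖ := by
            refine sum_le_sum fun ℓ _ => ?_
            rw [norm_smul, Real.norm_eq_abs]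
            calc |typeIICoeffB u ℓ| * ‖S ℓ‖ ≤ 1 * ‖S ℓ‖ :=
                  mul_le_mul_of_nonneg_right (abs_typeIICoeffB_le u ℓ) (norm_nonneg _)
              _ = ‖S ℓ‖ := one_mul _
    refine h2.trans ?_
    refine (sum_Ioc_le_sum_blocks_Ico hq u (x / v) (fun ℓ => norm_nonneg _)).trans
      (sum_le_sum fun i _ => ?_)
    refine (sum_block_le_sqrt_mul_sqrt i _).trans (le_of_eq ?_)
    rfl

end Literature.NumberTheory.LFunctions.MRVaughan
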